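import Summits.ResolutionOfSingularities.ResolutionOfSingularities.Theorems.DescentDescentPerfectToAllSeparableOverFg
import Mathlib.FieldTheory.Separable
import Mathlib.RingTheory.PowerBasis
import Mathlib.Algebra.CharP.Lemmas

/-!
# `DescentPerfectToAll` (stmt-ResolutionOfSingularities-0549) holds for ground fields algebraic over
# `𝔽_p(t₁, …, tₙ)` with `t₁, …, tₙ` `p`-independent — the finite-`p`-basis layer of the crux

Route `ResolutionOfSingularities/Descent`, crux `DescentPerfectToAll` (resolution over perfect fields of
characteristic `p` ⇒ resolution over all fields of characteristic `p`). Helper (OURS; not a statement of any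
manuscript). `DescentDescentPerfectToAllSeparableOverFg.lean` proves the crux's conclusion for every ground
field separable algebraic over a finitely generated subfield, and `DescentDescentPerfectToAllTrdegOne.lean`
feeds it with the one-generator criterion (`t ∉ k^p`, `k` algebraic over `𝔽_p(t)` ⇒ `k/𝔽_p(t)` separable).
This file proves the `n`-generator criterion, i.e. the classical fact that a finite `p`-INDEPENDENT family over
which the field is algebraic is a SEPARATING transcendence basis (Mac Lane 1939; Zariski–Samuel, Commutative
Algebra I, Ch. II §17, Thms 41 and 43; Kunz, Kähler Differentials, Cor. A.1.5 — there for finitely generated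
extensions; here for arbitrary algebraic ones, by Mac Lane's criterion):

* `linearIndepOn_pow_of_digits` — MAC LANE'S CRITERION FROM DIGIT EXPANSIONS (abstract form): if a subfield
  `F ≤ k` admits a finite family `m : A → k` such that every `c ∈ F` is `∑ₐ mₐ dₐ^p` with `dₐ ∈ F`, and
  `∑ₐ mₐ eₐ^p = 0 ⇒ e = 0` for `e : A → k` (the `mₐ` are `k^p`-free), then `F`-linearly independent finite
  families in `k` have `F`-linearly independent `p`-th powers.
* `isSeparable_of_linearIndepOn_pow` — Mac Lane's condition + algebraic ⇒ `Algebra.IsSeparable F k`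
  (an inseparable `a` has `minpoly = g(X^p)`; `1, a, …, a^{deg g}` are independent but their `p`-th powers
  satisfy `g`).
* `prod_pow_mul_prod_pow_eq`, `digits_mul`, `exists_digits_of_mem_closure_range` — DIGIT EXPANSION IN
  `𝔽_p(t₁, …, tₙ)`: every element of `closure (range t)` is `∑_α t^α d_α^p`, the sum over reduced exponents
  `α : ι → Fin p`, with all `d_α ∈ closure (range t)` (ring closure by carrying exponents, then
  `y / z = y z^{p-1} / z^p`).
* `linearIndepOn_pow_closure_range`, `isSeparable_closure_range_of_isAlgebraic` — if the reduced monomials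
  `t^α` (`α : ι → Fin p`) are `k^p`-free (`∑_α t^α e_α^p = 0 ⇒ e = 0`, i.e. `t` is `p`-INDEPENDENT in `k`,
  Bourbaki A.V.§13) and `k` is algebraic over `𝔽_p(t) = closure (range t)`, then `k/𝔽_p(t)` is separable.
* `hasResolution_of_perfectRes_of_pIndependent` / `descentPerfectToAll_finitePBasis` — **the crux's
  conclusion for every ground field `k` algebraic over `𝔽_p(t₁, …, tₙ)` for some `p`-independent
  `t₁, …, tₙ ∈ k`**, i.e. for every field of finite transcendence degree `n` over `𝔽_p` whose `p`-rank
  `log_p [k : k^p]` is also `n` (imperfection "as small as the transcendence degree allows"): all finitely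
  generated fields, all their separable algebraic extensions, and nothing else in finite transcendence degree.
  All dimensions of `X`. For `n = 1` this is `descentPerfectToAll_trdegOne`; for `n = 0` the perfect case.

What this layer does NOT settle: ground fields whose `p`-rank is smaller than the transcendence degree
(`𝔽_p(t)(u^{1/p^∞})`, covered separately by `Theorems.hasResolution_of_perfectRes_of_essFiniteType`) or of
infinite transcendence degree and finite `p`-rank (`𝔽_p((t))`, the standing witness of the residual of
stmt-0549: separable over no subfield essentially of finite type over a perfect field; cf.
`DescentDescentPerfectToAllCountableReduction.lean`).
-/

noncomputable section

set_option linter.dupNamespace false -- mandated namespace of this single-conjunct summit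

open CategoryTheory CategoryTheory.Limits AlgebraicGeometry Polynomial
open Literature.AlgebraicGeometry.Resolution

namespace Summit.ResolutionOfSingularities.ResolutionOfSingularities.Theorems

section MacLane

variable {p : ℕ} [Fact p.Prime] {k : Type} [Field k] [CharP k p]

/-- **Mac Lane's criterion from digit expansions.** Let `F ≤ k` be a subfield and `m : A → k` a finite
family such that (i) `∑ₐ mₐ eₐ^p = 0` forces `e = 0` (the `mₐ` are linearly independent over `k^p`) and
(ii) every `c ∈ F` has an expansion `c = ∑ₐ mₐ dₐ^p` with digits `dₐ ∈ F`. Then every `F`-linearly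
independent finite family in `k` has `F`-linearly independent `p`-th powers: expand the coefficients of a
relation in digits, regroup by the `mₐ`, and read off `F`-relations among the original family. [folklore] -/
theorem linearIndepOn_pow_of_digits (F : Subfield k) {A : Type} [Fintype A] (m : A → k)
    (hm : ∀ e : A → k, ∑ a, m a * e a ^ p = 0 → ∀ a, e a = 0)
    (hdig : ∀ c ∈ F, ∃ d : A → k, (∀ a, d a ∈ F) ∧ c = ∑ a, m a * d a ^ p)
    (s : Finset k) (hs : LinearIndepOn F _root_.id (↑s : Set k)) :
    LinearIndepOn F (fun x : k => x ^ p) (↑s : Set k) := by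
  classical
  have hp : p.Prime := Fact.out
  haveI : ExpChar k p := ExpChar.prime hp
  rw [LinearIndepOn, linearIndependent_iff'] at hs ⊢
  intro u g hrel i hi
  -- digits of the coefficients
  choose d hd hdsum using fun i : ↥(↑s : Set k) => hdig (g i : k) (g i).2
  -- the relation, regrouped by the `mₐ`
  have hzero : ∑ a, m a * (∑ i ∈ u, d i a * (i : k)) ^ p = 0 := by
    rw [← hrel]
    simp_rw [sum_pow_char, Finset.mul_sum, mul_pow]
    rw [Finset.sum_comm]
    refine Finset.sum_congr rfl fun i _ => ?_
    rw [Algebra.smul_def, show algebraMap F k (g i) = (g i : k) from rfl, hdsum i, Finset.sum_mul]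
    refine Finset.sum_congr rfl fun a _ => ?_
    ring
  have hdig0 := hm _ hzero
  -- each digit family is an `F`-relation among the `i`'s, hence vanishes
  have hdz : ∀ a, ∀ i ∈ u, d i a = 0 := by
    intro a
    have hrela : ∑ i ∈ u, (⟨d i a, hd i a⟩ : F) • _root_.id (i : k) = 0 := by
      rw [← hdig0 a]
      refine Finset.sum_congr rfl fun i _ => ?_
      rw [Algebra.smul_def]
      rfl
    intro i hi
    have := hs u (fun i => ⟨d i a, hd i a⟩) hrela i hi
    exact congrArg Subtype.val this
  apply Subtype.ext
  rw [hdsum i]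
  change ∑ a, m a * d i a ^ p = ((0 : F) : k)
  rw [ZeroMemClass.coe_zero]
  refine Finset.sum_eq_zero fun a _ => ?_
  rw [hdz a i hi, zero_pow hp.ne_zero, mul_zero]

variable (p) in
/-- **Mac Lane's condition and algebraicity give separability.** If `F`-linearly independent finite
families in `k` have `F`-linearly independent `p`-th powers and `k / F` is algebraic, then `k / F` is
separable: otherwise some `a ∈ k` has `minpoly_F(a) = g(X^p)` with `m = deg g ≥ 1`; the powers
`1, a, …, a^m` are `F`-independent (`m < p·m = deg minpoly`), so `1, a^p, …, a^{pm}` would be independent —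
but `g(a^p) = 0`. [folklore] -/
theorem isSeparable_of_linearIndepOn_pow (F : Subfield k)
    (H : ∀ s : Finset k, LinearIndepOn F _root_.id (↑s : Set k) →
      LinearIndepOn F (fun x : k => x ^ p) (↑s : Set k))
    [Algebra.IsAlgebraic F k] : Algebra.IsSeparable F k := by
  classical
  have hp : p.Prime := Fact.out
  haveI : CharP F p := (algebraMap F k).charP Subtype.val_injective p
  -- Mac Lane's criterion in family form
  have H' : ∀ (ι : Type) [Fintype ι] (v : ι → k), LinearIndependent F v →
      LinearIndependent F (fun i => v i ^ p) := by
    intro ι _ v hv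
    have h := H (Finset.univ.image v) (by simpa using hv.linearIndepOn_id)
    simpa only [Finset.coe_image, Finset.coe_univ, Set.image_univ,
      linearIndepOn_range_iff hv.injective, Function.comp_def] using h
  refine ⟨fun a => ?_⟩
  have hint : IsIntegral F a := Algebra.IsIntegral.isIntegral a
  have hirr : Irreducible (minpoly F a) := minpoly.irreducible hint
  rcases separable_or p hirr with hsep | ⟨-, g, hg, hga⟩
  · exact hsep
  · exfalso
    set m := g.natDegree with hm
    have hm1 : 1 ≤ m := natDegree_pos_iff_degree_pos.mpr (degree_pos_of_irreducible hg)
    have hd : (minpoly F a).natDegree = m * p := by rw [← hga, natDegree_expand]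
    have hle : m + 1 ≤ (minpoly F a).natDegree := by
      rw [hd]
      calc m + 1 ≤ m + m := by omega
        _ = m * 2 := by ring
        _ ≤ m * p := Nat.mul_le_mul_left m hp.two_le
    -- `1, a, …, a^m` are `F`-linearly independent, hence so are their `p`-th powers
    have hli := (linearIndependent_pow (K := F) a).comp (Fin.castLE hle) (Fin.castLE_injective hle)
    have hv : LinearIndependent F (fun i : Fin (m + 1) => a ^ (i : ℕ)) := hli
    have hw := H' (Fin (m + 1)) _ hv
    -- but `g(a^p) = 0` is a nontrivial relation among them
    have hrel : ∑ i : Fin (m + 1), g.coeff i • (a ^ (i : ℕ)) ^ p = 0 := by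
      have h1 : aeval (a ^ p) g = 0 := by rw [← expand_aeval, hga, minpoly.aeval]
      rw [aeval_eq_sum_range' (Nat.lt_succ_self m), Finset.sum_range] at h1
      rw [← h1]
      refine Finset.sum_congr rfl fun i _ => ?_
      rw [← pow_mul, mul_comm, pow_mul]
    have hcoeff := Fintype.linearIndependent_iff.mp hw _ hrel ⟨m, Nat.lt_succ_self m⟩
    have hg0 : g ≠ 0 := hg.ne_zero
    exact hg0 (leadingCoeff_eq_zero.mp hcoeff)

end MacLane

/-! ## Digit expansion in `𝔽_p(t₁, …, tₙ)` by reduced monomials `t^α`, `α : ι → Fin p` -/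

section Digits

variable {p : ℕ} [Fact p.Prime] {k : Type} [Field k] [CharP k p]
variable {ι : Type} [Fintype ι] [DecidableEq ι]

omit [Fact p.Prime] [CharP k p] [DecidableEq ι] in
/-- **Carrying exponents.** The product of two reduced monomials `t^α · t^β` (`α, β : ι → Fin p`) is the
reduced monomial `t^{α+β}` (sum in `Fin p`, i.e. exponents reduced mod `p`) times the `p`-th power of the
carry monomial `∏ᵢ tᵢ^{⌊(αᵢ+βᵢ)/p⌋}`. [folklore] -/
theorem prod_pow_mul_prod_pow_eq (t : ι → k) (α β : ι → Fin p) :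
    (∏ i, t i ^ (α i : ℕ)) * ∏ i, t i ^ (β i : ℕ) =
      (∏ i, t i ^ ((α + β) i : ℕ)) * (∏ i, t i ^ (((α i : ℕ) + β i) / p)) ^ p := by
  rw [← Finset.prod_pow, ← Finset.prod_mul_distrib, ← Finset.prod_mul_distrib]
  refine Finset.prod_congr rfl fun i _ => ?_
  rw [Pi.add_apply, Fin.val_add, ← pow_mul, ← pow_add, ← pow_add, Nat.mod_add_div']

/-- **Digit expansions multiply.** If `x = ∑_α t^α d_α^p` and `y = ∑_β t^β e_β^p` with digits in a subfield
`F` containing the `tᵢ`, then `x y = ∑_γ t^γ D_γ^p` with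
`D_γ = ∑_{α+β=γ} (∏ᵢ tᵢ^{⌊(αᵢ+βᵢ)/p⌋}) d_α e_β ∈ F` (Frobenius is additive). [folklore] -/
theorem digits_mul (F : Subfield k) (t : ι → k) (ht : ∀ i, t i ∈ F) {x y : k}
    (hx : ∃ d : (ι → Fin p) → k, (∀ α, d α ∈ F) ∧ x = ∑ α, (∏ i, t i ^ (α i : ℕ)) * d α ^ p)
    (hy : ∃ d : (ι → Fin p) → k, (∀ α, d α ∈ F) ∧ y = ∑ α, (∏ i, t i ^ (α i : ℕ)) * d α ^ p) :
    ∃ d : (ι → Fin p) → k, (∀ α, d α ∈ F) ∧ x * y = ∑ α, (∏ i, t i ^ (α i : ℕ)) * d α ^ p := by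
  classical
  have hp : p.Prime := Fact.out
  haveI : ExpChar k p := ExpChar.prime hp
  obtain ⟨d, hd, rfl⟩ := hx
  obtain ⟨e, he, rfl⟩ := hy
  refine ⟨fun γ => ∑ q ∈ Finset.univ.filter (fun q : (ι → Fin p) × (ι → Fin p) => q.1 + q.2 = γ),
      (∏ i, t i ^ (((q.1 i : ℕ) + q.2 i) / p)) * (d q.1 * e q.2), fun γ => ?_, ?_⟩
  · exact sum_mem fun q _ => mul_mem (prod_mem fun i _ => pow_mem (ht i) _) (mul_mem (hd _) (he _))
  · rw [Finset.sum_mul_sum, ← Finset.sum_product', Finset.univ_product_univ,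
      ← Finset.sum_fiberwise Finset.univ (fun q : (ι → Fin p) × (ι → Fin p) => q.1 + q.2)]
    refine Finset.sum_congr rfl fun γ _ => ?_
    rw [sum_pow_char, Finset.mul_sum]
    refine Finset.sum_congr rfl fun q hq => ?_
    rw [← (Finset.mem_filter.mp hq).2]
    linear_combination (d q.1 * e q.2) ^ p * prod_pow_mul_prod_pow_eq t q.1 q.2

variable (p) in
/-- **Digit expansion in `𝔽_p(t₁, …, tₙ)`.** Every element `c` of the subfield `closure (range t)` generated
by a finite family `t : ι → k` is `c = ∑_α t^α d_α^p`, the sum over reduced exponents `α : ι → Fin p`, with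
all digits `d_α ∈ closure (range t)`: the elements admitting such an expansion form a subring containing the
`tᵢ` (products by `digits_mul`), and `y / z = (y z^{p-1}) / z^p`. [folklore] -/
theorem exists_digits_of_mem_closure_range (t : ι → k) {c : k}
    (hc : c ∈ Subfield.closure (Set.range t)) :
    ∃ d : (ι → Fin p) → k, (∀ α, d α ∈ Subfield.closure (Set.range t)) ∧
      c = ∑ α, (∏ i, t i ^ (α i : ℕ)) * d α ^ p := by
  classical
  have hp : p.Prime := Fact.out
  haveI : ExpChar k p := ExpChar.prime hp
  set F := Subfield.closure (Set.range t) with hF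
  have htF : ∀ i, t i ∈ F := fun i => Subfield.subset_closure ⟨i, rfl⟩
  -- Step 1: the ring generated by the `tᵢ`
  have hR : ∀ x ∈ Subring.closure (Set.range t), ∃ d : (ι → Fin p) → k, (∀ α, d α ∈ F) ∧
      x = ∑ α, (∏ i, t i ^ (α i : ℕ)) * d α ^ p := by
    intro x hx
    induction hx using Subring.closure_induction with
    | mem x hx =>
      obtain ⟨j, rfl⟩ := hx
      -- `t_j` is the reduced monomial with exponent `δ_j`
      let ε : ι → Fin p := fun i => if i = j then ⟨1, hp.one_lt⟩ else ⟨0, hp.pos⟩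
      refine ⟨Pi.single ε 1, fun α => ?_, ?_⟩
      · by_cases hα : α = ε
        · rw [hα, Pi.single_eq_same]; exact one_mem F
        · rw [Pi.single_eq_of_ne hα]; exact zero_mem F
      · rw [Finset.sum_eq_single ε (fun α _ hα => by
            rw [Pi.single_eq_of_ne hα, zero_pow hp.ne_zero, mul_zero])
          (fun h => absurd (Finset.mem_univ ε) h), Pi.single_eq_same, one_pow, mul_one,
          Finset.prod_eq_single j (fun i _ hij => by simp only [ε, if_neg hij, pow_zero])
          (fun h => absurd (Finset.mem_univ j) h)]
        simp only [ε, if_pos rfl, pow_one]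
    | zero => exact ⟨fun _ => 0, fun _ => zero_mem F, by simp [zero_pow hp.ne_zero]⟩
    | one =>
      let ε : ι → Fin p := fun _ => ⟨0, hp.pos⟩
      refine ⟨Pi.single ε 1, fun α => ?_, ?_⟩
      · by_cases hα : α = ε
        · rw [hα, Pi.single_eq_same]; exact one_mem F
        · rw [Pi.single_eq_of_ne hα]; exact zero_mem F
      · rw [Finset.sum_eq_single ε (fun α _ hα => by
            rw [Pi.single_eq_of_ne hα, zero_pow hp.ne_zero, mul_zero])
          (fun h => absurd (Finset.mem_univ ε) h), Pi.single_eq_same, one_pow, mul_one]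
        exact (Finset.prod_eq_one fun i _ => by simp only [ε, pow_zero]).symm
    | add x y _ _ hx hy =>
      obtain ⟨d, hd, rfl⟩ := hx
      obtain ⟨e, he, rfl⟩ := hy
      refine ⟨fun α => d α + e α, fun α => add_mem (hd α) (he α), ?_⟩
      rw [← Finset.sum_add_distrib]
      refine Finset.sum_congr rfl fun α _ => ?_
      rw [add_pow_char, mul_add]
    | neg x _ hx =>
      obtain ⟨d, hd, rfl⟩ := hx
      refine ⟨fun α => -d α, fun α => neg_mem (hd α), ?_⟩
      rw [← Finset.sum_neg_distrib]
      refine Finset.sum_congr rfl fun α _ => ?_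
      rw [neg_pow, neg_one_pow_char, neg_one_mul, mul_neg]
    | mul x y _ _ hx hy => exact digits_mul F t htF hx hy
  -- Step 2: quotients
  obtain ⟨y, hy, z, hz, rfl⟩ := Subfield.mem_closure_iff.mp hc
  have hzF : z ∈ F := Subfield.subring_closure_le _ hz
  by_cases hz0 : z = 0
  · exact ⟨fun _ => 0, fun _ => zero_mem F, by simp [hz0, zero_pow hp.ne_zero]⟩
  obtain ⟨d, hd, hdsum⟩ := hR (y * z ^ (p - 1)) (mul_mem hy (pow_mem hz _))
  refine ⟨fun α => d α / z, fun α => div_mem (hd α) hzF, ?_⟩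
  have key : y / z = (y * z ^ (p - 1)) / z ^ p := by
    rw [← Nat.succ_pred_eq_of_pos hp.pos, pow_succ, Nat.succ_sub_one]
    field_simp
  rw [key, hdsum, Finset.sum_div]
  refine Finset.sum_congr rfl fun α _ => ?_
  rw [div_pow, mul_div_assoc]

/-- **Mac Lane's criterion over `𝔽_p(t₁, …, tₙ)` for a `p`-independent family.** If the reduced monomials
`t^α` (`α : ι → Fin p`) are linearly independent over `k^p` — `∑_α t^α e_α^p = 0 ⇒ e = 0`, i.e. the family
`t` is `p`-independent in `k` — then `closure (range t)`-linearly independent finite families in `k` have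
independent `p`-th powers. [folklore] -/
theorem linearIndepOn_pow_closure_range (t : ι → k)
    (ht : ∀ e : (ι → Fin p) → k, ∑ α, (∏ i, t i ^ (α i : ℕ)) * e α ^ p = 0 → ∀ α, e α = 0)
    (s : Finset k) (hs : LinearIndepOn (Subfield.closure (Set.range t)) _root_.id (↑s : Set k)) :
    LinearIndepOn (Subfield.closure (Set.range t)) (fun x : k => x ^ p) (↑s : Set k) :=
  linearIndepOn_pow_of_digits _ (fun α : ι → Fin p => ∏ i, t i ^ (α i : ℕ)) ht
    (fun _ hc => exists_digits_of_mem_closure_range p t hc) s hs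

variable (p) in
/-- **A finite `p`-independent family over which the field is algebraic is a separating transcendence
basis**: if `t : ι → k` is `p`-independent in `k` (reduced monomials `k^p`-free) and `k` is algebraic over
`𝔽_p(t) = closure (range t)`, then `k / 𝔽_p(t)` is separable (Mac Lane 1939; Zariski–Samuel I, Ch. II §17,
Thms 41/43 and Kunz, Cor. A.1.5 for finitely generated `k`). [folklore] -/
theorem isSeparable_closure_range_of_isAlgebraic (t : ι → k)
    (ht : ∀ e : (ι → Fin p) → k, ∑ α, (∏ i, t i ^ (α i : ℕ)) * e α ^ p = 0 → ∀ α, e α = 0)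
    [Algebra.IsAlgebraic (Subfield.closure (Set.range t)) k] :
    Algebra.IsSeparable (Subfield.closure (Set.range t)) k :=
  isSeparable_of_linearIndepOn_pow p _ (linearIndepOn_pow_closure_range t ht)

end Digits

/-! ## The crux's conclusion over ground fields algebraic over `𝔽_p(t₁, …, tₙ)`, `t` `p`-independent -/

/-- **Resolution over perfect fields ⇒ resolution over every ground field algebraic over `𝔽_p(t₁, …, tₙ)`
with `t₁, …, tₙ` `p`-independent** (equivalently: every ground field of finite transcendence degree over
`𝔽_p` equal to its `p`-rank), for reduced separated schemes of finite type of any dimension: such a field is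
separable algebraic over the finitely generated subfield `closure (range t)`
(`isSeparable_closure_range_of_isAlgebraic`), so `hasResolution_of_perfectRes_of_isSeparable_fg` applies.
[folklore] -/
theorem hasResolution_of_perfectRes_of_pIndependent (p : ℕ) [Fact p.Prime]
    (H : ∀ (κ : Type) [Field κ] [CharP κ p] [PerfectField κ] (Z : Scheme.{0}) (h : Z ⟶ Spec (.of κ)),
      IsSeparated h → LocallyOfFiniteType h → QuasiCompact h → IsReduced Z → Scheme.HasResolution Z)
    (k : Type) [Field k] [CharP k p] {ι : Type} [Fintype ι] [DecidableEq ι] (t : ι → k)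
    (ht : ∀ e : (ι → Fin p) → k, ∑ α, (∏ i, t i ^ (α i : ℕ)) * e α ^ p = 0 → ∀ α, e α = 0)
    [Algebra.IsAlgebraic (Subfield.closure (Set.range t)) k]
    (X : Scheme.{0}) (f : X ⟶ Spec (.of k)) [IsSeparated f] [LocallyOfFiniteType f] [QuasiCompact f]
    [IsReduced X] : Scheme.HasResolution X := by
  classical
  haveI := isSeparable_closure_range_of_isAlgebraic p t ht
  exact hasResolution_of_perfectRes_of_isSeparable_fg p H k (Subfield.closure (Set.range t))
    (Finset.univ.image t) (by rw [Finset.coe_image, Finset.coe_univ, Set.image_univ]) X f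

/-- **The finite-`p`-basis layer of the crux `DescentPerfectToAll`, proved** (binder shape of stmt-0549
with the hypotheses "`t : ι → k` finite and `p`-independent" and "`k` algebraic over `closure (range t)`"
inserted): resolution over all perfect fields of characteristic `p` gives resolution over every such ground
field `k`. [folklore] -/
theorem descentPerfectToAll_finitePBasis :
    ∀ p : ℕ, p.Prime → (∀ (k : Type) [Field k] [CharP k p] [PerfectField k] (X : Scheme.{0})
      (f : X ⟶ Spec (.of k)), IsSeparated f → LocallyOfFiniteType f → QuasiCompact f →
        IsReduced X → Scheme.HasResolution X) →
    ∀ (k : Type) [Field k] [CharP k p] (ι : Type) [Fintype ι] [DecidableEq ι] (t : ι → k),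
      (∀ e : (ι → Fin p) → k, ∑ α, (∏ i, t i ^ (α i : ℕ)) * e α ^ p = 0 → ∀ α, e α = 0) →
      Algebra.IsAlgebraic (Subfield.closure (Set.range t)) k →
      ∀ (X : Scheme.{0}) (f : X ⟶ Spec (.of k)),
        IsSeparated f → LocallyOfFiniteType f → QuasiCompact f → IsReduced X →
          Scheme.HasResolution X := by
  intro p hp H k _ _ ι _ _ t ht halg X f _ _ _ _
  haveI : Fact p.Prime := ⟨hp⟩
  haveI := halg
  exact hasResolution_of_perfectRes_of_pIndependent p (fun κ _ _ _ Z h a b c d => H κ Z h a b c d)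
    k t ht X f

end Summit.ResolutionOfSingularities.ResolutionOfSingularities.Theorems

end
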